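import Summits.ResolutionOfSingularities.ResolutionOfSingularities.Theorems.EquisingularLiftEquisingularLiftNatCarrierDeltaModelFrame
import Summits.ResolutionOfSingularities.ResolutionOfSingularities.Theorems.EquisingularLiftEquisingularLiftNatCarrierDeltaOfConeForm
import Summits.ResolutionOfSingularities.ResolutionOfSingularities.Theorems.EquisingularLiftEquisingularLiftNatCarrierDeltaSectionFrameDim
import Summits.ResolutionOfSingularities.ResolutionOfSingularities.Theorems.EquisingularLiftEquisingularLiftNatDeltaConeLiftPlane
import Summits.ResolutionOfSingularities.ResolutionOfSingularities.Theorems.EquisingularLiftEquisingularLiftNatTangentConeFibreAdm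
import Summits.ResolutionOfSingularities.ResolutionOfSingularities.Theorems.EquisingularLiftEquisingularLiftNatTangentConeFibreReduced
import Summits.ResolutionOfSingularities.ResolutionOfSingularities.Theorems.EquisingularLiftEquisingularLiftNatSquarefreeInitialForm
import HarnessLib

/-!
# [OURS · L1 W4.5(b) · EL♮] HΔTC₃ — THE CARRIER LIFT HΔ(AdmTC) IN AMBIENT DIMENSION `3 + 1` (supplier of T-INST₂)

Crux chain w45b (cell `res-hironaka`, slot W4.5(b)), working crux **EL♮** = stmt-ResolutionOfSingularities-20038 (child EL♮(3) =
stmt-20148), route EquisingularLift, line `sections`, registered stub `stub_elnat_tcDeltaPointResolution`. HONEST FRAMING: OURS; NOT a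
statement of any manuscript; AI-written, weaker than expert review. No `sorry`; standard axioms. Filed `--supports stmt-20038 --as helper`.

WHAT. `exists_carrierDelta_of_admTC_three` = the lift hypothesis **HΔ(AdmTC) with the T-DIM antecedent** of res-D-pv-029's T-INST₂
`stub_elnat_tcDeltaPointResolution_of_carrierLift_dim` (…NatTcDeltaPointResolutionDim, p521291) VERBATIM at `n = 3`
(`ringKrullDim 𝒪_{X',s(s₀)} = 3 + 1`), for every algebraically closed field `k`: in every section blow-up situation over a complete DVR
`O ↠ k` with the model squares of T-ISO-0⁺, the reduced tangent-cone trace `Z = υ⁻¹{x} ∩ closure υ⁻¹(W ∖ {x})` of a hypersurface germ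
`W ∋ x` lifts to the in-carrier Δ-centre `C = St_{τ₁}(K) + 𝓘(s)·𝒪_{X₁}` — regular, flat over `O`, inside the exceptional divisor, with
`C · 𝒪_{F₂} = 𝓘(Z)`. So the registered stub at `n = 3` follows from p521291 and this file (res-L1-w45b-lead-2 closes
`stub_elnat_tcDeltaPointResolution_three`).

PROOF (assembly; every step is a tree theorem, cited by name in the code).
(S1) res-type-100's SECTION FRAME at `p = j x` (`exists_sectionFrame_forall_dim_at`): coordinates `c` of `𝓘(s)_p`, `θ_R : 𝒪_p/(c) ≅ O`
the identity on constants, `(c) + (ϖ) = 𝔪_p`, `ϖ ∉ (c)`, `dim 𝒪_p = n + 1`; the T-DIM antecedent pins `n = 3`. The MODEL FRAME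
(…NatCarrierDeltaModelFrame, with res-D-pv-029's …ComapFrame): `c̄ = j^♯ c` generates `𝔪_x`, `𝒪_{F₁,x}` is regular, `𝓘(s)·𝒪_{F₁} = 𝓘_{{x}}`,
and the residue model `π₀ : O ↠ k₀ := 𝒪_{F₁,x}/(c̄)` has kernel `𝔪_O` (`k₀ ≅ κ_O` is infinite).
(S2) res-type-097's T-TCONE downstairs: the initial FORM `Φ₁ ∈ 𝒪_{F₁,x}[T]` of `closure W` at `c̄` (`exists_isHomogeneous_of_isPrincipal`)
and its SQUARE-FREE REDUCTION `G`, `g = Ḡ ∈ k₀[T₀,T₁,T₂]` (`exists_isHomogeneous_squarefree_reduction`).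
(S3) res-type-032's T-ΔLIFT IN THE PLANE (`exists_isHomogeneous_lift_deltaRegular_plane_comp`, over `k₀` with `π₀`): a form
`Φ₀ ∈ O[T]` with `π₀ Φ₀ = g` whose affine cones are Δ-regular along `ϖ`.
(S4) res-type-100's T-CARRIER-Δ ONE-THEOREM FORM (`carrierDelta_clauses_of_coneForm'`): the Δ-centre of the O-cone `K`,
`K_p = (Φ₀(c))`, is regular, flat over `O`, inside the exceptional divisor, and `K_p = (ι_* Φ₀ (c))`.
(S5) SPECIAL FIBRE: res-D-pv-029's (v) (`comap_strictTransformIdeal_sup_comap_eq_of_model`, p517803) gives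
`C·𝒪_{F₂} = St_υ(K·𝒪_{F₁}) + 𝔪_x·𝒪_{F₂}`, and res-type-097's T-TCONE (2) (`vanishingIdeal_carrierTrace_eq_strictTransformIdeal_sup_comap`)
identifies the right-hand side with `𝓘(υ⁻¹{x} ∩ closure υ⁻¹(closure W ∖ {x}))`, `= 𝓘(Z)` by res-L1-w45b-lead-2's
`closure_preimage_diff_singleton_eq_of_isBlowup` (p514617).

References (index only): res-L1-w45b-lead-2 TARGET-T-ISO-0PLUS / SkeletonELnat-v5.1 (OURS planning texts), the cited tree files.
-/

set_option linter.dupNamespace false -- mandated namespace `Summit.<Summit>.<Problem>` of this single-conjunct summit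
set_option linter.overlappingInstances false -- the registered text carries `[IsDomain O] [IsDiscreteValuationRing O]`

noncomputable section

open CategoryTheory CategoryTheory.Limits AlgebraicGeometry TopologicalSpace IsLocalRing
open Literature.AlgebraicGeometry.Resolution
open AlgebraicGeometry.Scheme.IdealSheafData

namespace Summit.ResolutionOfSingularities.ResolutionOfSingularities.Cruxes.EquisingularLiftNat.Sections

/-- **HΔTC₃: the carrier lift HΔ(AdmTC) with T-DIM, ambient dimension `3 + 1`** (see the module docstring).
[cite: Matsumura1987, Thm. 14.2; StacksProject, Tag 0804] -/
theorem exists_carrierDelta_of_admTC_three (k : Type) [Field k] [IsAlgClosed k] :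
    ∀ (O : Type) [CommRing O] [IsDomain O] [IsDiscreteValuationRing O] [IsAdicComplete (IsLocalRing.maximalIdeal O) O]
    [IsAlgClosed (IsLocalRing.ResidueField O)] (θ : O →+* k), Function.Surjective θ →
    ∀ (X' : AlgebraicGeometry.Scheme.{0}) (r' : X' ⟶ AlgebraicGeometry.Spec (.of O)) [AlgebraicGeometry.IsIntegral X']
    [IsLocallyNoetherian X'], Literature.AlgebraicGeometry.Resolution.Scheme.IsRegular X' → AlgebraicGeometry.IsProper r' →
    ∀ (U : X'.Opens), AlgebraicGeometry.Smooth (U.ι ≫ r') →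
    ∀ (s : AlgebraicGeometry.Spec (.of O) ⟶ X'), s ≫ r' = 𝟙 _ → s (IsLocalRing.closedPoint O) ∈ U →
    ringKrullDim (X'.presheaf.stalk (s (IsLocalRing.closedPoint O))) = ((3 + 1 : ℕ) : WithBot ℕ∞) →
    ∀ (X₁ : AlgebraicGeometry.Scheme.{0}) (τ₁ : X₁ ⟶ X'), Literature.AlgebraicGeometry.Resolution.IsBlowup τ₁ s.ker →
    ∀ (F₁ : AlgebraicGeometry.Scheme.{0}) [AlgebraicGeometry.IsIntegral F₁] (j : F₁ ⟶ X')
    (t : F₁ ⟶ AlgebraicGeometry.Spec (.of k)),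
    IsPullback j t r' (AlgebraicGeometry.Spec.map (CommRingCat.ofHom θ)) →
    ∀ (x : F₁) (hx : IsClosed ({x} : Set F₁)), s (IsLocalRing.closedPoint O) = j x →
    ∀ (F₂ : AlgebraicGeometry.Scheme.{0}) [AlgebraicGeometry.IsIntegral F₂] (υ : F₂ ⟶ F₁),
    Literature.AlgebraicGeometry.Resolution.IsBlowup υ
    (AlgebraicGeometry.Scheme.IdealSheafData.vanishingIdeal (⟨{x}, hx⟩ : TopologicalSpace.Closeds F₁)) →
    ∀ (j₂ : F₂ ⟶ X₁) (t₂ : F₂ ⟶ AlgebraicGeometry.Spec (.of k)),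
    IsPullback j₂ t₂ (τ₁ ≫ r') (AlgebraicGeometry.Spec.map (CommRingCat.ofHom θ)) → j₂ ≫ τ₁ = υ ≫ j →
    (s.ker.comap τ₁).comap j₂ =
    (AlgebraicGeometry.Scheme.IdealSheafData.vanishingIdeal (⟨{x}, hx⟩ : TopologicalSpace.Closeds F₁)).comap υ →
    ∀ (W : Set F₁) (hZ : IsClosed (υ ⁻¹' {x} ∩ closure (υ ⁻¹' (W \ {x})))), x ∈ W →
    ¬ (υ ⁻¹' {x} ⊆ closure (υ ⁻¹' (W \ {x}))) →
    (∃ U₁ : F₁.affineOpens, x ∈ (U₁ : F₁.Opens) ∧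
    ((AlgebraicGeometry.Scheme.IdealSheafData.vanishingIdeal
    (⟨closure W, isClosed_closure⟩ : TopologicalSpace.Closeds F₁)).ideal U₁).IsPrincipal) →
    Set.Finite {z : ↥(AlgebraicGeometry.Scheme.IdealSheafData.vanishingIdeal
    (⟨υ ⁻¹' {x} ∩ closure (υ ⁻¹' (W \ {x})), hZ⟩ : TopologicalSpace.Closeds F₂)).subscheme |
    ¬ IsRegularLocalRing ((AlgebraicGeometry.Scheme.IdealSheafData.vanishingIdeal
    (⟨υ ⁻¹' {x} ∩ closure (υ ⁻¹' (W \ {x})), hZ⟩ : TopologicalSpace.Closeds F₂)).subscheme.presheaf.stalk z)} →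
    ∃ C : X₁.IdealSheafData, Literature.AlgebraicGeometry.Resolution.Scheme.IsRegular C.subscheme ∧
    AlgebraicGeometry.Flat (C.subschemeι ≫ τ₁ ≫ r') ∧
    (C.support : Set X₁) ⊆ ((s.ker.comap τ₁).support : Set X₁) ∧
    C.comap j₂ = AlgebraicGeometry.Scheme.IdealSheafData.vanishingIdeal
    (⟨υ ⁻¹' {x} ∩ closure (υ ⁻¹' (W \ {x})), hZ⟩ : TopologicalSpace.Closeds F₂) := by
  intro O _ _ _ _ _ θ hθ X' r' _ _ hregX hproper U hU s hs hsU hdim4 X₁ τ₁ hτ₁ F₁ _ j t hsq x hx hss F₂ _ υ hυ j₂ t₂ hsq₂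
    hcomm hE W hZ hxW hnot hU₁ hfin
  classical
  haveI := hproper
  haveI : IsClosedImmersion (Spec.map (CommRingCat.ofHom θ)) := IsClosedImmersion.spec_of_surjective _ hθ
  haveI : IsClosedImmersion j := MorphismProperty.IsStableUnderBaseChange.of_isPullback hsq.flip inferInstance
  haveI : IsLocallyNoetherian X₁ := by
    haveI : IsProper τ₁ := hτ₁.isProper
    exact LocallyOfFiniteType.isLocallyNoetherian τ₁
  haveI : IsLocallyNoetherian F₁ := LocallyOfFiniteType.isLocallyNoetherian j
  haveI : IsLocallyNoetherian F₂ := by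
    haveI : IsProper υ := hυ.isProper
    exact LocallyOfFiniteType.isLocallyNoetherian υ
  obtain ⟨ϖ, hϖ⟩ := IsDiscreteValuationRing.exists_irreducible O
  have hϖO : ϖ ∈ maximalIdeal O := by rw [hϖ.maximalIdeal_eq]; exact Ideal.mem_span_singleton_self ϖ
  -- (S1) the frame at `p = j x`; the T-DIM antecedent pins `n = 3`
  rw [hss] at hdim4
  obtain ⟨n, c, θR, hcI, hqr, hdom, hθR, h𝔪, hϖc, hdimn⟩ :=
    exists_sectionFrame_forall_dim_at O r' s hs (j x) hss (hregX (j x)) ϖ hϖ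
  have hn : n + 1 = 3 + 1 := by
    have h := hdimn.symm.trans hdim4
    exact_mod_cast h
  obtain rfl : n = 3 := by omega
  haveI := hdom
  -- the model frame downstairs
  have hcb𝔪 := span_stalkMap_eq_maximalIdeal_of_model θ hθ r' j t hsq x ϖ hϖO c h𝔪
  have hcbar := isQuasiRegular_stalkMap_model O k θ hθ r' j t hsq x c hqr ϖ hϖ hϖc
  haveI hFreg : IsRegularLocalRing (F₁.presheaf.stalk x) :=
    isRegularLocalRing_stalk_of_model O k θ hθ r' j t hsq x (hregX (j x)) ϖ hϖ c h𝔪 hϖc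
  have hJ : s.ker.comap j = vanishingIdeal ⟨{x}, hx⟩ :=
    comap_ker_eq_vanishingIdeal_of_model θ hθ r' s hs j t hsq x hx hss c hcI hcb𝔪
  haveI hmax : (Ideal.span (Set.range fun i => (j.stalkMap x).hom (c i))).IsMaximal := by
    rw [hcb𝔪]; exact maximalIdeal.isMaximal _
  -- (S2) T-TCONE downstairs: the initial form `Φ₁` of `closure W` at `c̄` and its square-free reduction `G`
  obtain ⟨U₁, hxU₁, hpr⟩ := hU₁
  obtain ⟨d, Φ₁, -, hΦ₁d, hΦ₁0, hW⟩ :=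
    exists_isHomogeneous_of_isPrincipal hx hυ (fun i => (j.stalkMap x).hom (c i)) hcb𝔪 W hxW U₁ hxU₁ hpr hnot
  obtain ⟨d', G, hGd', hG0, -, hR1, hR1', hR2, hR2sq⟩ :=
    exists_isHomogeneous_squarefree_reduction (fun i => (j.stalkMap x).hom (c i)) hmax Φ₁ hΦ₁d hΦ₁0
  -- (S3) the residue model `π₀ : O ↠ k₀ = 𝒪_{F₁,x}/(c̄)` and T-ΔLIFT in the plane over `k₀`
  letI : Field (F₁.presheaf.stalk x ⧸ Ideal.span (Set.range fun i => (j.stalkMap x).hom (c i))) :=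
    Ideal.Quotient.field _
  obtain ⟨π₀, hπ₀def⟩ : ∃ π₀ : O →+* F₁.presheaf.stalk x ⧸ Ideal.span (Set.range fun i => (j.stalkMap x).hom (c i)),
      π₀ = ((Ideal.Quotient.mk (Ideal.span (Set.range fun i => (j.stalkMap x).hom (c i)))).comp
        (j.stalkMap x).hom).comp ((Scheme.ΓSpecIso (.of O)).inv ≫ r'.appTop ≫ X'.presheaf.Γgerm (j x)).hom :=
    ⟨_, rfl⟩
  obtain ⟨hπ₀, hkerπ₀⟩ := residueModel_surjective_and_ker θ hθ r' j t hsq x c θR hθR hcb𝔪 hπ₀def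
  haveI : Infinite (F₁.presheaf.stalk x ⧸ Ideal.span (Set.range fun i => (j.stalkMap x).hom (c i))) := by
    haveI : Infinite (ResidueField O) := inferInstance
    exact Infinite.of_injective (β := ResidueField O)
      ((Ideal.quotEquivOfEq hkerπ₀.symm).trans (RingHom.quotientKerEquivOfSurjective hπ₀))
      ((Ideal.quotEquivOfEq hkerπ₀.symm).trans (RingHom.quotientKerEquivOfSurjective hπ₀)).injective
  have hρ₀ : (θR.toRingHom.comp (Ideal.Quotient.mk (Ideal.span (Set.range c)))).comp
      ((Scheme.ΓSpecIso (.of O)).inv ≫ r'.appTop ≫ X'.presheaf.Γgerm (j x)).hom = RingHom.id O :=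
    RingHom.ext fun b => hθR b
  have hgsq : ∀ i : Fin 3, Squarefree (dehomogenize i
      (MvPolynomial.map (Ideal.Quotient.mk (Ideal.span (Set.range fun i => (j.stalkMap x).hom (c i)))) G)) := fun i => by
    have h := hR2sq i
    rwa [map_dehomogenize] at h
  obtain ⟨Φ₀, hΦ₀d, hΦ₀g, h032⟩ := exists_isHomogeneous_lift_deltaRegular_plane_comp hϖ π₀ hπ₀ hkerπ₀
    ((Scheme.ΓSpecIso (.of O)).inv ≫ r'.appTop ≫ X'.presheaf.Γgerm (j x)).hom
    (θR.toRingHom.comp (Ideal.Quotient.mk (Ideal.span (Set.range c)))) hρ₀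
    (MvPolynomial.map (Ideal.Quotient.mk (Ideal.span (Set.range fun i => (j.stalkMap x).hom (c i)))) G)
    (hGd'.map _) hG0 hgsq
  -- consequences: `Φ₀ ≢ 0 mod 𝔪_O`, `ι_* Φ₀ ≢ 0 mod (c)`, `j^♯ ι_* Φ₀ ≡ g mod (c̄)`
  have hΦ₀res : MvPolynomial.map (IsLocalRing.residue O) Φ₀ ≠ 0 := by
    intro h
    apply hG0
    rw [← hΦ₀g]
    refine map_eq_zero_of_coeff_mem_ker π₀ fun m => ?_
    rw [hkerπ₀, ← IsLocalRing.ker_residue]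
    exact coeff_mem_ker_of_map_eq_zero (IsLocalRing.residue O) h m
  have hΦ₀ne : Φ₀ ≠ 0 := by
    intro h0
    apply hG0
    rw [← hΦ₀g, h0, map_zero]
  have hΦι : MvPolynomial.map (Ideal.Quotient.mk (Ideal.span (Set.range c)))
      (MvPolynomial.map ((Scheme.ΓSpecIso (.of O)).inv ≫ r'.appTop ≫ X'.presheaf.Γgerm (j x)).hom Φ₀) ≠ 0 := by
    intro h
    apply hΦ₀ne
    have h2 := congrArg (MvPolynomial.map θR.toRingHom) h
    rwa [MvPolynomial.map_map, MvPolynomial.map_map, hρ₀, MvPolynomial.map_id, map_zero] at h2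
  have hΦbg : MvPolynomial.map (Ideal.Quotient.mk (Ideal.span (Set.range fun i => (j.stalkMap x).hom (c i))))
      (MvPolynomial.map (j.stalkMap x).hom
        (MvPolynomial.map ((Scheme.ΓSpecIso (.of O)).inv ≫ r'.appTop ≫ X'.presheaf.Γgerm (j x)).hom Φ₀)) =
      MvPolynomial.map (Ideal.Quotient.mk (Ideal.span (Set.range fun i => (j.stalkMap x).hom (c i)))) G := by
    rw [MvPolynomial.map_map, MvPolynomial.map_map, ← hπ₀def, hΦ₀g]
  have hΦbar : MvPolynomial.map (Ideal.Quotient.mk (Ideal.span (Set.range fun i => (j.stalkMap x).hom (c i))))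
      (MvPolynomial.map (j.stalkMap x).hom
        (MvPolynomial.map ((Scheme.ΓSpecIso (.of O)).inv ≫ r'.appTop ≫ X'.presheaf.Γgerm (j x)).hom Φ₀)) ≠ 0 := by
    rw [hΦbg]; exact hG0
  -- (S4) T-CARRIER-Δ one-theorem form: the Δ-centre of the O-cone `K` with `K_p = (ι_* Φ₀ (c))`
  obtain ⟨hCreg, hCflat, hCsupp, hK⟩ := carrierDelta_clauses_of_coneForm' O r' s hs (j x) hss (hregX (j x)) τ₁ hτ₁ ϖ hϖ
    c hcI hdim4 Φ₀ hΦ₀d hΦ₀res (fun ρ hρ i => forall_ideal_quotient_span_singleton_congr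
      ((map_dehomogenize_map_of_comp_eq_id _ ρ hρ i Φ₀).trans
        (map_dehomogenize_map_of_comp_eq_id _ _ hρ₀ i Φ₀).symm) (MvPolynomial.C ϖ) (h032 i))
  refine ⟨_, hCreg, hCflat, hCsupp, ?_⟩
  -- (S5) the special fibre: (v), then T-TCONE (2) for `closure W`, then `closure W ↦ W`
  have hΦιd : (MvPolynomial.map ((Scheme.ΓSpecIso (.of O)).inv ≫ r'.appTop ≫ X'.presheaf.Γgerm (j x)).hom Φ₀).IsHomogeneous d' :=
    hΦ₀d.map _
  rw [comap_strictTransformIdeal_sup_comap_eq_of_model τ₁ s.ker _ hτ₁ j υ j₂ hcomm x hx hυ hJ c hcI hqr _ hΦιd hΦι hK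
    hcbar hΦbar]
  -- T-TCONE (2) at `closure W` with `K_G := K·𝒪_{F₁}`, `G := j^♯ ι_* Φ₀`
  have hK' : stalkIdeal ((Spec.map (CommRingCat.ofHom (Ideal.Quotient.mk (Ideal.span {MvPolynomial.eval c (MvPolynomial.map
      ((Scheme.ΓSpecIso (.of O)).inv ≫ r'.appTop ≫ X'.presheaf.Γgerm (j x)).hom Φ₀)}))) ≫ X'.fromSpecStalk (j x)).ker.comap j) x =
      Ideal.span {MvPolynomial.eval (fun i => (j.stalkMap x).hom (c i)) (MvPolynomial.map (j.stalkMap x).hom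
        (MvPolynomial.map ((Scheme.ΓSpecIso (.of O)).inv ≫ r'.appTop ≫ X'.presheaf.Γgerm (j x)).hom Φ₀))} := by
    rw [stalkIdeal_comap_eq_map_stalkMap, hK, Ideal.map_span, Set.image_singleton, ringHom_eval_eq_eval_map]
  have hZ' : IsClosed (υ ⁻¹' {x} ∩ closure (υ ⁻¹' (((⟨closure W, isClosed_closure⟩ : Closeds F₁) : Set F₁) \ {x}))) := by
    rw [Closeds.coe_mk, ← closure_preimage_diff_singleton_eq_of_isBlowup hx hυ W]; exact hZ
  have hcl : (⟨υ ⁻¹' {x} ∩ closure (υ ⁻¹' (W \ {x})), hZ⟩ : Closeds F₂) =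
      ⟨υ ⁻¹' {x} ∩ closure (υ ⁻¹' (((⟨closure W, isClosed_closure⟩ : Closeds F₁) : Set F₁) \ {x})), hZ'⟩ :=
    Closeds.ext (by rw [Closeds.coe_mk, Closeds.coe_mk, Closeds.coe_mk, closure_preimage_diff_singleton_eq_of_isBlowup hx hυ W])
  rw [hcl]
  exact (vanishingIdeal_carrierTrace_eq_strictTransformIdeal_sup_comap hx hυ (fun i => (j.stalkMap x).hom (c i)) hcb𝔪 hcbar
    ⟨closure W, isClosed_closure⟩ _ Φ₁ _ hΦ₁d (hΦιd.map _) hΦ₁0 hΦbar hW hK' (by rw [hΦbg]; exact hR1)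
    (by rw [hΦbg]; exact hR1') (fun i => by rw [map_dehomogenize, hΦbg, ← map_dehomogenize]; exact hR2 i) hZ').symm

/-- **`𝓘(s) · 𝒪_{F₁} = 𝓘_{{x}}`, frame-free** (res-L1-w45b-stub-1's Q2, 2026-08-27T10:44:46Z): in a model square over a DVR
`O ↠ k` with a section `s` of the separated `r'` through `s(s₀) = j x` (`x` closed, `𝒪_{X',j x}` regular), the section ideal
restricts to the special fibre as the ideal of the reduced point `x` — `comap_ker_eq_vanishingIdeal_of_model` fed by the section
frame (`exists_sectionFrame_forall_dim_at`) and `span_stalkMap_eq_maximalIdeal_of_model`. [folklore] -/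
theorem comap_ker_eq_vanishingIdeal_of_model' (O : Type) [CommRing O] [IsDomain O] [IsDiscreteValuationRing O]
    (k : Type) [Field k] (θ : O →+* k) (hθ : Function.Surjective θ) {X' F₁ : Scheme.{0}} (r' : X' ⟶ Spec (.of O))
    [IsSeparated r'] (s : Spec (.of O) ⟶ X') (hs : s ≫ r' = 𝟙 _) (j : F₁ ⟶ X') (t : F₁ ⟶ Spec (.of k))
    (hsq : IsPullback j t r' (Spec.map (CommRingCat.ofHom θ))) (x : F₁) (hx : IsClosed ({x} : Set F₁))
    (hss : s (IsLocalRing.closedPoint O) = j x) (hreg : IsRegularLocalRing (X'.presheaf.stalk (j x))) :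
    s.ker.comap j = vanishingIdeal ⟨{x}, hx⟩ := by
  obtain ⟨ϖ, hϖ⟩ := IsDiscreteValuationRing.exists_irreducible O
  have hϖO : ϖ ∈ maximalIdeal O := by rw [hϖ.maximalIdeal_eq]; exact Ideal.mem_span_singleton_self ϖ
  obtain ⟨n, c, θR, hcI, -, -, -, h𝔪, -, -⟩ := exists_sectionFrame_forall_dim_at O r' s hs (j x) hss hreg ϖ hϖ
  exact comap_ker_eq_vanishingIdeal_of_model θ hθ r' s hs j t hsq x hx hss c hcI
    (span_stalkMap_eq_maximalIdeal_of_model θ hθ r' j t hsq x ϖ hϖO c h𝔪)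

end Summit.ResolutionOfSingularities.ResolutionOfSingularities.Cruxes.EquisingularLiftNat.Sections

end
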